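import Literature.NumberTheory.LFunctions.PrimeNumberTheoremErrorTermProofs
import Literature.NumberTheory.LFunctions.LogIntegralProofs
import HarnessLib

/-!
# The gain of the midpoint sieve: `2π(x/2) - π(x) ≳ (log 2) x/(log x)²`

Topic `Literature/NumberTheory/LFunctions`. Everything in this file is PROVED.

Richards (*On the incompatibility of two conjectures concerning primes*, Bull. AMS 80 (1974),
§2.5 "Gains and losses", formula (*)) computes the "gain" of the midpoint sieve of
Hensley–Richards: `2π(x/2) - π(x) ∼ (log 2) · x/(log x)²`, remarking that "the proper
asymptotic law (which must have an error term smaller than `x/(log x)²`)" is needed, i.e. the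
prime number theorem with de la Vallée Poussin's error term rather than `π(x) ∼ x/log x`.
We prove the lower half of (*) in the form consumed by Theorem 4.1 (`ρ*(x) - π(x) → ∞`):

* `Literature.NumberTheory.LFunctions.eventually_richards_gain`: for every `ε > 0`, for all large real `x`,
  `(log 2 - ε) · x/(log x)² ≤ 2π(⌊x/2⌋) - π(⌊x⌋)`;
* `Literature.NumberTheory.LFunctions.eventually_richards_gain_nat`: the same along `x ∈ ℕ` (with `x / 2` in `ℕ`).

## Proof

From the tree's PROVED prime number theorem with error term
(`Literature.ChebyshevThetaDeLaValleePoussin_holds.logPow 2`: `|ϑ(t) - t| ≤ C t/(log t)²` for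
`t ≥ 2`) and Mathlib's Abel-summation identity
`π(x) = ϑ(x)/log x + ∫₂ˣ ϑ(t) dt/(t log² t)` (`Chebyshev.primeCounting_eq_theta_div_log_add_integral`):
with `u = x/2`,
`2π(u) - π(x) = [2ϑ(u)/log u - ϑ(x)/log x] + ∫₂ᵘ ϑ/(t log²t) - ∫ᵤˣ ϑ/(t log²t)`; the bracket is
`x/log u - x/log x + O(x/log³x) = (log 2) x/(log u · log x) + O(x/log³ x) ≥ (log 2) x/log²x + O(x/log³x)`,
while `∫₂ᵘ ≥ Li₂(u) - C·Li₄(u) ≥ u/log²u - 2/log²2 - C Li₄(u)` (integration by parts,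
`Literature.NumberTheory.LFunctions.offsetLogIntegralPow_integration_by_parts`) and `∫ᵤˣ ≤ u/log²u + C u/log⁴u` cancel to
within `O(x/log³ x)` (`Literature.NumberTheory.LFunctions.two_mul_primeCounting_half_sub_ge`); all error terms are
`o(x/log² x)`.

## References

* I. Richards, Bull. Amer. Math. Soc. 80 (1974) 419–438, §2.5 (*). [Richards1974]
* H. L. Montgomery, R. C. Vaughan, *Multiplicative Number Theory I*, Theorem 6.9 (the error
  term). [MontgomeryVaughan2007]
-/

open Real Filter Asymptotics MeasureTheory Set
open scoped Chebyshev

namespace Literature.NumberTheory.LFunctions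

/-! ### Inputs -/

/-- The prime number theorem with error `O(x/log² x)` in the form used here: there is `C ≥ 0`
with `|ϑ(t) - t| ≤ C t/(log t)²` for all `t ≥ 2` (from the de la Vallée Poussin error term,
PROVED in the tree). [cite: MontgomeryVaughan2007, Theorem 6.9 (6.13)] -/
theorem exists_abs_theta_sub_self_le_div_log_sq :
    ∃ C : ℝ, 0 ≤ C ∧ ∀ t : ℝ, 2 ≤ t → |θ t - t| ≤ C * t / Real.log t ^ 2 := by
  obtain ⟨C, hC⟩ := ChebyshevThetaDeLaValleePoussin_holds.logPow 2
  refine ⟨max C 0, le_max_right _ _, fun t ht => ?_⟩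
  have h := hC t ht
  rw [Real.rpow_two] at h
  refine h.trans ?_
  have hlog : 0 < Real.log t := Real.log_pos (by linarith)
  rw [mul_div_assoc, mul_div_assoc]
  exact mul_le_mul_of_nonneg_right (le_max_left _ _) (by positivity)

/-- `Li_k` is monotone on `[2, ∞)` (nonnegative integrand). [folklore] -/
theorem offsetLogIntegralPow_mono (k : ℕ) {a b : ℝ} (ha : 2 ≤ a) (hab : a ≤ b) :
    offsetLogIntegralPow k a ≤ offsetLogIntegralPow k b := by
  have h1a : (1 : ℝ) < a := by linarith
  have h1b : (1 : ℝ) < b := by linarith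
  unfold offsetLogIntegralPow
  rw [← intervalIntegral.integral_add_adjacent_intervals
    (intervalIntegrable_inv_log_pow k one_lt_two h1a) (intervalIntegrable_inv_log_pow k h1a h1b)]
  have : 0 ≤ ∫ t in a..b, (Real.log t)⁻¹ ^ k :=
    intervalIntegral.integral_nonneg hab fun t ht =>
      pow_nonneg (inv_nonneg.2 (Real.log_nonneg (by linarith [ht.1]))) k
  linarith

/-- The integrand `ϑ(t)/(t log² t)` of the Abel identity is interval integrable on `[a, b]`
for `2 ≤ a ≤ b` (Mathlib: integrable on `[2, b]`). [folklore] -/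
theorem intervalIntegrable_theta_div {a b : ℝ} (ha : 2 ≤ a) (hab : a ≤ b) :
    IntervalIntegrable (fun t => θ t / (t * Real.log t ^ 2)) volume a b := by
  rw [intervalIntegrable_iff_integrableOn_Icc_of_le hab]
  exact (Chebyshev.integrableOn_theta_div_id_mul_log_sq b).mono_set (Icc_subset_Icc_left ha)

/-! ### The pointwise inequality -/

/-- **The gain, pointwise form.** If `|ϑ(t) - t| ≤ C t/log²t` for `t ≥ 2` (`C ≥ 0`), then for
`x ≥ 4`,
`2π(⌊x/2⌋) - π(⌊x⌋) ≥ (log 2) x/log²x - [2Cx/log³(x/2) + 2/log²2 + C·Li₄(x/2) + C(x/2)/log⁴(x/2)]`.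
[cite: Richards1974, §2.5 (*)] -/
theorem two_mul_primeCounting_half_sub_ge {C : ℝ} (hC0 : 0 ≤ C)
    (hC : ∀ t : ℝ, 2 ≤ t → |θ t - t| ≤ C * t / Real.log t ^ 2) {x : ℝ} (hx : 4 ≤ x) :
    Real.log 2 * x / Real.log x ^ 2 -
        (2 * C * x / Real.log (x / 2) ^ 3 + 2 / Real.log 2 ^ 2 +
          C * offsetLogIntegralPow 4 (x / 2) + C * (x / 2) / Real.log (x / 2) ^ 4) ≤
      2 * (Nat.primeCounting ⌊x / 2⌋₊ : ℝ) - Nat.primeCounting ⌊x⌋₊ := by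
  set u := x / 2 with hu_def
  have hu : 2 ≤ u := by rw [hu_def]; linarith
  have hux : u ≤ x := by rw [hu_def]; linarith
  have hxu : x = 2 * u := by rw [hu_def]; ring
  have hu0 : 0 < u := by linarith
  have hx0 : 0 < x := by linarith
  set l := Real.log u with hl_def
  set L := Real.log x with hL_def
  have hl : 0 < l := Real.log_pos (by linarith)
  have hLl : L = l + Real.log 2 := by
    rw [hL_def, hl_def, hxu, Real.log_mul two_ne_zero hu0.ne']; ring
  have hl2 : 0 < Real.log 2 := Real.log_pos one_lt_two
  have hlL : l ≤ L := by linarith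
  have hL : 0 < L := by linarith
  -- Abel summation (Mathlib)
  set f : ℝ → ℝ := fun t => θ t / (t * Real.log t ^ 2) with hf
  have hπx : (Nat.primeCounting ⌊x⌋₊ : ℝ) = θ x / L + ∫ t in (2 : ℝ)..x, f t :=
    Chebyshev.primeCounting_eq_theta_div_log_add_integral (by linarith)
  have hπu : (Nat.primeCounting ⌊u⌋₊ : ℝ) = θ u / l + ∫ t in (2 : ℝ)..u, f t :=
    Chebyshev.primeCounting_eq_theta_div_log_add_integral hu
  have hsplit : ∫ t in (2 : ℝ)..x, f t = (∫ t in (2 : ℝ)..u, f t) + ∫ t in u..x, f t :=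
    (intervalIntegral.integral_add_adjacent_intervals (intervalIntegrable_theta_div le_rfl hu)
      (intervalIntegrable_theta_div hu hux)).symm
  -- (T1), (T2): the boundary terms
  have hθu : u - C * u / l ^ 2 ≤ θ u := by
    have := hC u hu; rw [abs_le] at this; linarith [this.1]
  have hθx : θ x ≤ x + C * x / L ^ 2 := by
    have := hC x (by linarith); rw [abs_le] at this; linarith [this.2]
  have h1 : (x - C * x / l ^ 2) / l ≤ 2 * (θ u / l) := by
    rw [← mul_div_assoc, div_le_div_iff_of_pos_right hl]
    have : x - C * x / l ^ 2 = 2 * (u - C * u / l ^ 2) := by rw [hxu]; ring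
    rw [this]
    linarith
  have h2 : θ x / L ≤ (x + C * x / L ^ 2) / L := div_le_div_of_nonneg_right hθx hL.le
  -- the main term: `x/l - x/L ≥ (log 2) x / L²`, and `C x/L³ ≤ C x/l³`
  have hmain : Real.log 2 * x / L ^ 2 ≤ x / l - x / L := by
    have heq : x / l - x / L = Real.log 2 * x / (l * L) := by
      rw [hLl]; field_simp; ring
    rw [heq, pow_two]
    exact div_le_div_of_nonneg_left (by positivity) (by positivity)
      (mul_le_mul_of_nonneg_right hlL hL.le)
  have hcube : C * x / L ^ 3 ≤ C * x / l ^ 3 :=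
    div_le_div_of_nonneg_left (by positivity) (by positivity)
      (pow_le_pow_left₀ hl.le hlL 3)
  have hT12 : Real.log 2 * x / L ^ 2 - 2 * C * x / l ^ 3 ≤
      (x - C * x / l ^ 2) / l - (x + C * x / L ^ 2) / L := by
    have e1 : (x - C * x / l ^ 2) / l = x / l - C * x / l ^ 3 := by
      field_simp
    have e2 : (x + C * x / L ^ 2) / L = x / L + C * x / L ^ 3 := by
      field_simp
    rw [e1, e2]
    have e3 : 2 * C * x / l ^ 3 = C * x / l ^ 3 + C * x / l ^ 3 := by ring
    linarith
  -- (T3): the integral over `[2, u]`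
  have hT3 : u * l⁻¹ ^ 2 - 2 * (Real.log 2)⁻¹ ^ 2 - C * offsetLogIntegralPow 4 u ≤
      ∫ t in (2 : ℝ)..u, f t := by
    have hlow : ∫ t in (2 : ℝ)..u, ((Real.log t)⁻¹ ^ 2 - C * (Real.log t)⁻¹ ^ 4) ≤
        ∫ t in (2 : ℝ)..u, f t := by
      refine intervalIntegral.integral_mono_on hu
        ((intervalIntegrable_inv_log_pow 2 one_lt_two (by linarith)).sub
          ((intervalIntegrable_inv_log_pow 4 one_lt_two (by linarith)).const_mul C))
        (intervalIntegrable_theta_div le_rfl hu) fun t ht => ?_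
      have ht2 : 2 ≤ t := ht.1
      have ht0 : 0 < t := by linarith
      have hlt : 0 < Real.log t := Real.log_pos (by linarith)
      have hθt : t - C * t / Real.log t ^ 2 ≤ θ t := by
        have := hC t ht2; rw [abs_le] at this; linarith [this.1]
      rw [hf]
      simp only
      rw [inv_pow, inv_pow, le_div_iff₀ (by positivity)]
      calc ((Real.log t ^ 2)⁻¹ - C * (Real.log t ^ 4)⁻¹) * (t * Real.log t ^ 2)
          = t - C * t / Real.log t ^ 2 := by field_simp
        _ ≤ θ t := hθt
    have hsub : ∫ t in (2 : ℝ)..u, ((Real.log t)⁻¹ ^ 2 - C * (Real.log t)⁻¹ ^ 4) =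
        offsetLogIntegralPow 2 u - C * offsetLogIntegralPow 4 u := by
      unfold offsetLogIntegralPow
      rw [intervalIntegral.integral_sub (intervalIntegrable_inv_log_pow 2 one_lt_two (by linarith))
        ((intervalIntegrable_inv_log_pow 4 one_lt_two (by linarith)).const_mul C),
        intervalIntegral.integral_const_mul]
    have hparts := offsetLogIntegralPow_integration_by_parts 2 (x := u) (by linarith)
    have hLi3 : 0 ≤ offsetLogIntegralPow 3 u := offsetLogIntegralPow_nonneg 3 hu
    rw [hsub] at hlow
    have : u * l⁻¹ ^ 2 - 2 * (Real.log 2)⁻¹ ^ 2 ≤ offsetLogIntegralPow 2 u := by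
      rw [hparts, hl_def]
      push_cast
      linarith
    linarith
  -- (T4): the integral over `[u, x]`
  have hT4 : ∫ t in u..x, f t ≤ u * l⁻¹ ^ 2 + C * u * l⁻¹ ^ 4 := by
    have hup : ∫ t in u..x, f t ≤ ∫ _ in u..x, (l⁻¹ ^ 2 + C * l⁻¹ ^ 4) := by
      refine intervalIntegral.integral_mono_on hux (intervalIntegrable_theta_div hu hux)
        intervalIntegrable_const fun t ht => ?_
      have htu : u ≤ t := ht.1
      have ht0 : 0 < t := by linarith
      have hlt : l ≤ Real.log t := Real.log_le_log hu0 htu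
      have hlt0 : 0 < Real.log t := by linarith
      have hθt : θ t ≤ t + C * t / Real.log t ^ 2 := by
        have := hC t (by linarith); rw [abs_le] at this; linarith [this.2]
      rw [hf]
      simp only
      rw [div_le_iff₀ (by positivity)]
      have hinv : (Real.log t)⁻¹ ≤ l⁻¹ := inv_anti₀ hl hlt
      have hinv0 : 0 ≤ (Real.log t)⁻¹ := inv_nonneg.2 hlt0.le
      have hi2 : (Real.log t)⁻¹ ^ 2 ≤ l⁻¹ ^ 2 := pow_le_pow_left₀ hinv0 hinv 2
      have hi4 : (Real.log t)⁻¹ ^ 4 ≤ l⁻¹ ^ 4 := pow_le_pow_left₀ hinv0 hinv 4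
      calc θ t ≤ t + C * t / Real.log t ^ 2 := hθt
        _ = ((Real.log t)⁻¹ ^ 2 + C * (Real.log t)⁻¹ ^ 4) * (t * Real.log t ^ 2) := by
            field_simp
        _ ≤ (l⁻¹ ^ 2 + C * l⁻¹ ^ 4) * (t * Real.log t ^ 2) := by
            apply mul_le_mul_of_nonneg_right _ (by positivity)
            nlinarith
    rw [intervalIntegral.integral_const, smul_eq_mul] at hup
    have hxu' : x - u = u := by rw [hxu]; ring
    rw [hxu'] at hup
    linarith
  -- assemble
  have hfin : u * l⁻¹ ^ 2 - 2 * (Real.log 2)⁻¹ ^ 2 - C * offsetLogIntegralPow 4 u -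
      (u * l⁻¹ ^ 2 + C * u * l⁻¹ ^ 4) =
      -(2 / Real.log 2 ^ 2) - C * offsetLogIntegralPow 4 u - C * u / l ^ 4 := by
    rw [inv_pow, inv_pow, inv_pow]
    field_simp
    ring
  rw [hπx, hπu, hsplit]
  linarith [hfin]

/-! ### The error terms are `o(x / log² x)` -/

/-- `x/(log x)^j = o(x/(log x)^k)` for `k < j`. [folklore] -/
theorem isLittleO_self_div_log_pow {j k : ℕ} (hkj : k < j) :
    (fun x : ℝ => x / Real.log x ^ j) =o[atTop] fun x => x / Real.log x ^ k := by
  refine (isLittleO_iff_tendsto' ?_).2 ?_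
  · filter_upwards [eventually_gt_atTop 1] with x hx h
    have hl : 0 < Real.log x := Real.log_pos hx
    exfalso
    have : 0 < x / Real.log x ^ k := div_pos (by linarith) (pow_pos hl k)
    linarith
  · have h0 : Tendsto (fun x : ℝ => (Real.log x)⁻¹ ^ (j - k)) atTop (nhds 0) := by
      have := (Real.tendsto_log_atTop.inv_tendsto_atTop).pow (j - k)
      rwa [zero_pow (by omega)] at this
    refine h0.congr' ?_
    filter_upwards [eventually_gt_atTop 1] with x hx
    have hl : 0 < Real.log x := Real.log_pos hx
    have hx0 : 0 < x := by linarith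
    obtain ⟨d, rfl⟩ := Nat.exists_eq_add_of_lt hkj
    rw [show k + d + 1 - k = d + 1 by omega, inv_pow, eq_div_iff (div_pos hx0 (pow_pos hl k)).ne']
    field_simp
    ring

/-- `x/(log x)² → ∞`. [folklore] -/
theorem tendsto_self_div_log_sq_atTop : Tendsto (fun x : ℝ => x / Real.log x ^ 2) atTop atTop := by
  refine (tendsto_self_mul_inv_log_pow_atTop 2).congr' ?_
  filter_upwards with x
  rw [inv_pow, div_eq_mul_inv]

/-- The error term of `two_mul_primeCounting_half_sub_ge` is `o(x/log² x)`. [folklore] -/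
theorem isLittleO_richards_gain_error (C : ℝ) :
    (fun x : ℝ => 2 * C * x / Real.log (x / 2) ^ 3 + 2 / Real.log 2 ^ 2 +
        C * offsetLogIntegralPow 4 (x / 2) + C * (x / 2) / Real.log (x / 2) ^ 4) =o[atTop]
      fun x => x / Real.log x ^ 2 := by
  -- `log (x/2) ≥ (log x)/2` for `x ≥ 4`
  have hhalf : ∀ x : ℝ, 4 ≤ x → Real.log x / 2 ≤ Real.log (x / 2) ∧ 0 < Real.log (x / 2) := by
    intro x hx
    have hx0 : 0 < x := by linarith
    have h2 : Real.log (x / 2) = Real.log x - Real.log 2 := by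
      rw [Real.log_div hx0.ne' two_ne_zero]
    have h4 : Real.log 4 = 2 * Real.log 2 := by
      rw [show (4 : ℝ) = 2 ^ 2 by norm_num, Real.log_pow]; ring
    have hlog4 : Real.log 4 ≤ Real.log x := Real.log_le_log (by norm_num) hx
    have hl2 : 0 < Real.log 2 := Real.log_pos one_lt_two
    refine ⟨by linarith, by linarith⟩
  -- term 1: `x / log(x/2)^3 ≤ 8 x / log x ^ 3`
  have h1 : (fun x : ℝ => 2 * C * x / Real.log (x / 2) ^ 3) =o[atTop]
      fun x => x / Real.log x ^ 2 := by
    have hO : (fun x : ℝ => x / Real.log (x / 2) ^ 3) =O[atTop] fun x => x / Real.log x ^ 3 := by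
      refine IsBigO.of_bound 8 ?_
      filter_upwards [eventually_ge_atTop 4] with x hx
      obtain ⟨hle, hpos⟩ := hhalf x hx
      have hx0 : 0 < x := by linarith
      have hl : 0 < Real.log x := Real.log_pos (by linarith)
      rw [Real.norm_of_nonneg (by positivity), Real.norm_of_nonneg (by positivity),
        div_le_iff₀ (pow_pos hpos 3)]
      calc x = 8 * (x / Real.log x ^ 3) * (Real.log x / 2) ^ 3 := by field_simp; ring
        _ ≤ 8 * (x / Real.log x ^ 3) * Real.log (x / 2) ^ 3 := by
            gcongr
    have := (hO.trans_isLittleO (isLittleO_self_div_log_pow (by norm_num : 2 < 3))).const_mul_left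
      (2 * C)
    refine this.congr' ?_ EventuallyEq.rfl
    filter_upwards with x
    ring
  -- term 2: the constant
  have h2 : (fun _ : ℝ => 2 / Real.log 2 ^ 2) =o[atTop] fun x => x / Real.log x ^ 2 :=
    isLittleO_const_left.2 (Or.inr (tendsto_abs_atTop_atTop.comp tendsto_self_div_log_sq_atTop))
  -- term 3: `Li₄(x/2) ≤ Li₄(x) ∼ x / log⁴ x`
  have h3 : (fun x : ℝ => C * offsetLogIntegralPow 4 (x / 2)) =o[atTop]
      fun x => x / Real.log x ^ 2 := by
    have hO : (fun x : ℝ => offsetLogIntegralPow 4 (x / 2)) =O[atTop] offsetLogIntegralPow 4 := by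
      refine IsBigO.of_bound 1 ?_
      filter_upwards [eventually_ge_atTop 4] with x hx
      have hx2 : 2 ≤ x / 2 := by linarith
      rw [one_mul, Real.norm_of_nonneg (offsetLogIntegralPow_nonneg 4 hx2),
        Real.norm_of_nonneg (offsetLogIntegralPow_nonneg 4 (by linarith))]
      exact offsetLogIntegralPow_mono 4 hx2 (by linarith)
    have hE := (isEquivalent_offsetLogIntegralPow_holds 4).isBigO
    exact ((hO.trans hE).trans_isLittleO
      (isLittleO_self_div_log_pow (by norm_num : 2 < 4))).const_mul_left C
  -- term 4: `(x/2)/log(x/2)^4 ≤ 8 x / log x ^ 4`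
  have h4 : (fun x : ℝ => C * (x / 2) / Real.log (x / 2) ^ 4) =o[atTop]
      fun x => x / Real.log x ^ 2 := by
    have hO : (fun x : ℝ => (x / 2) / Real.log (x / 2) ^ 4) =O[atTop] fun x => x / Real.log x ^ 4 := by
      refine IsBigO.of_bound 8 ?_
      filter_upwards [eventually_ge_atTop 4] with x hx
      obtain ⟨hle, hpos⟩ := hhalf x hx
      have hx0 : 0 < x := by linarith
      have hl : 0 < Real.log x := Real.log_pos (by linarith)
      rw [Real.norm_of_nonneg (by positivity), Real.norm_of_nonneg (by positivity),
        div_le_iff₀ (pow_pos hpos 4)]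
      calc x / 2 = 8 * (x / Real.log x ^ 4) * (Real.log x / 2) ^ 4 := by field_simp; ring
        _ ≤ 8 * (x / Real.log x ^ 4) * Real.log (x / 2) ^ 4 := by
            gcongr
    have := (hO.trans_isLittleO (isLittleO_self_div_log_pow (by norm_num : 2 < 4))).const_mul_left C
    refine this.congr' ?_ EventuallyEq.rfl
    filter_upwards with x
    ring
  exact ((h1.add h2).add h3).add h4

/-! ### Richards' gain -/

/-- **Richards' gain (lower half of (*), §2.5):** for every `ε > 0`, for all sufficiently large
real `x`, `2π(x/2) - π(x) ≥ (log 2 - ε) x/(log x)²` ("our GAIN `= 2π(x/2) - π(x)` …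
`∼ (log 2)[x/(log x)²]`", which needs "de la Vallée Poussin's "sharp" form of the prime
number theorem"). PROVED from the tree's prime number theorem with error term.
[cite: Richards1974, §2.5 (*)] -/
theorem eventually_richards_gain {ε : ℝ} (hε : 0 < ε) :
    ∀ᶠ x : ℝ in atTop, (Real.log 2 - ε) * (x / Real.log x ^ 2) ≤
      2 * (Nat.primeCounting ⌊x / 2⌋₊ : ℝ) - Nat.primeCounting ⌊x⌋₊ := by
  obtain ⟨C, hC0, hC⟩ := exists_abs_theta_sub_self_le_div_log_sq
  filter_upwards [(isLittleO_richards_gain_error C).def hε, eventually_ge_atTop 4] with x hE hx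
  have hmain := two_mul_primeCounting_half_sub_ge hC0 hC hx
  have hx0 : 0 < x := by linarith
  have hl : 0 < Real.log x := Real.log_pos (by linarith)
  have hl2 : 0 < Real.log (x / 2) := Real.log_pos (by linarith)
  have hLi : 0 ≤ offsetLogIntegralPow 4 (x / 2) := offsetLogIntegralPow_nonneg 4 (by linarith)
  have hEpos : 0 ≤ 2 * C * x / Real.log (x / 2) ^ 3 + 2 / Real.log 2 ^ 2 +
      C * offsetLogIntegralPow 4 (x / 2) + C * (x / 2) / Real.log (x / 2) ^ 4 := by positivity
  rw [Real.norm_of_nonneg hEpos, Real.norm_of_nonneg (by positivity)] at hE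
  have : (Real.log 2 - ε) * (x / Real.log x ^ 2) =
      Real.log 2 * x / Real.log x ^ 2 - ε * (x / Real.log x ^ 2) := by ring
  linarith

/-- **Richards' gain along the integers:** for every `ε > 0` and all large `x ∈ ℕ`,
`(log 2 - ε) x/(log x)² ≤ 2π(x/2) - π(x)` (`x/2` rounded down). [cite: Richards1974, §2.5 (*)] -/
theorem eventually_richards_gain_nat {ε : ℝ} (hε : 0 < ε) :
    ∀ᶠ x : ℕ in atTop, (Real.log 2 - ε) * ((x : ℝ) / Real.log x ^ 2) ≤
      2 * (Nat.primeCounting (x / 2) : ℝ) - Nat.primeCounting x := by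
  filter_upwards [tendsto_natCast_atTop_atTop.eventually (eventually_richards_gain hε)] with x hx
  rwa [Nat.floor_div_ofNat, Nat.floor_natCast] at hx

end Literature.NumberTheory.LFunctions
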